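import Summits.CriticalPhenomena.PercolationContinuityZ3.Theorems.Transplant.FKDoubleFanOneSidedConeSGadgets
import HarnessLib

/-!
# Double fans `K₂ ∨ P_{m+1}`: the DEGENERATE-GADGET cells of `HypBaS` are one-atom identities

Helper file (`--supports stmt-CriticalPhenomena-4575`), FK sub-lane `prim-bschramm-fk-3` (gen 37); builds on p205010 (kernel theorem, internal audit
signed; external expert review pending).  No named facts, no sorries; standard axioms.  Memo `bschramm/prim-bschramm-fk-3/FAR-CROSS-XII.md` §5.

`…OneSidedConeSGadgets` reduces `HypBaS q` to three families of gadgets: degenerate `⟨f₀, f_ab, 0, 0, 0⟩`, `Λ`-floor and roof.  The degenerate family is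
discharged here by an explicit ONE-ATOM identity — the first certificate of the programme: the image of any rest under a degenerate gadget is the rank-one
cut bivector `𝟙̂ ∧ ê_ab` times `(f₀² + f₀f_ab)·N^{(bc)}(w) ≥ 0` (**`imgA_degGadget`**), and a `b`-spoke maps that bivector to the image of the `bc`-letter
state under the rim-step gadget: `∧²BC_{y'}(𝟙̂ ∧ ê_ab) = imgA q (rimStep q y' fanInit) (edgeBC 1)` (**`opBC_cutBiv`**).  Hence
**`opBC_imgA_deg_mem`** and **`hypBaS_of_lamfloor_roof`**: `HypBaS q` follows from the `Λ`-floor-gadget cells and the roof-gadget cells alone (`0 < q < 1`).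
[folklore]
-/

noncomputable section

namespace Summit.CriticalPhenomena.PercolationContinuityZ3.Theorems

namespace FK

namespace ThreeApex

/-- **Degenerate gadgets give the cut bivector**: `imgA q ⟨f₀,f_ab,0,0,0⟩ w = (f₀² + f₀f_ab)·N^{(bc)}(w) · (𝟙̂ ∧ ê_ab)`. [folklore] -/
theorem imgA_degGadget (q f0 fab : ℝ) (w : V5) :
    imgA q ⟨f0, fab, 0, 0, 0⟩ w = Biv.smul ((f0 ^ 2 + f0 * fab) * masterN q (swapAB w)) ⟨1, 0, 0, 1, -1, -1, 0, 0, 1, 1⟩ := by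
  ext <;> simp only [imgA, wedgeH, fanCombo, conv, edgeAC, detach, V5.total, hx, hy, hz, Biv.smul, masterN, swapAB] <;> ring

/-- **A `b`-spoke on the cut bivector is a one-atom image**: `∧²BC_{y'}(𝟙̂ ∧ ê_ab) = imgA q (rimStep q y' fanInit) (edgeBC 1)`. [folklore] -/
theorem opBC_cutBiv (q y' : ℝ) :
    opBC y' (⟨1, 0, 0, 1, -1, -1, 0, 0, 1, 1⟩ : Biv) = imgA q (rimStep q y' fanInit) (edgeBC 1) := by
  ext <;> simp only [opBC, opTb, opWb, Biv.lin3, Biv.add, Biv.smul, imgA, wedgeH, fanCombo, fanInit, conv, edgeAC, edgeBC, detach, delta0,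
    rimStep, V5.total, hx, hy, hz] <;> ring

/-- `opBC` commutes with scalars. [folklore] -/
theorem opBC_smul' (y c : ℝ) (β : Biv) : opBC y (Biv.smul c β) = Biv.smul c (opBC y β) := by
  ext <;> simp only [opBC, opTb, opWb, Biv.lin3, Biv.add, Biv.smul] <;> ring

/-- **The degenerate-gadget cells hold**: `opBC y' (imgA q ⟨f₀,f_ab,0,0,0⟩ w) ∈ osConeS q` for `w ∈ InS q`, `f₀, f_ab ≥ 0`, `y' ∈ [0,1]`
(`0 < q ≤ 1`). [folklore] -/
theorem opBC_imgA_deg_mem {q : ℝ} (hq0 : 0 < q) (hq1 : q ≤ 1) {w : V5} (hw : InS q w) {y' f0 fab : ℝ} (hy0 : 0 ≤ y') (hy1 : y' ≤ 1)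
    (hf0 : 0 ≤ f0) (hfab : 0 ≤ fab) : opBC y' (imgA q ⟨f0, fab, 0, 0, 0⟩ w) ∈ osConeS q := by
  rw [imgA_degGadget, opBC_smul', opBC_cutBiv q y']
  have hF : InS q (rimStep q y' fanInit) := (InKE.rim hy0 hy1 (fanInit_inKE q)).inS hq0 hq1
  have hb : InS q (edgeBC 1) := (IsLetter.bc zero_le_one le_rfl).inS hq0 hq1
  have hc : 0 ≤ (f0 ^ 2 + f0 * fab) * masterN q (swapAB w) := mul_nonneg (by positivity) hw.valid.nBC
  intro γ hγ
  rw [pairH_smul_left]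
  exact mul_nonneg hc (imgA_mem_osConeS hF hb γ hγ)

/-- **`HypBaS` from the `Λ`-floor-gadget cells and the roof-gadget cells alone** (`0 < q < 1`). [folklore] -/
theorem hypBaS_of_lamfloor_roof {q : ℝ} (hq0 : 0 < q) (hq1 : q < 1)
    (hlam : ∀ (w : V5) (y' W y X Z uL : ℝ), InS q w → 0 ≤ y' → y' ≤ 1 → 0 ≤ X → 0 ≤ Z → 0 ≤ uL → uL ≤ y → q * y < W →
      0 ≤ W - q * y - X - Z → uL * (W - q * y) = X * y + X * Z + y * Z →
      opBC y' (imgA q (swapAC (swapAB (vecB q W y X Z uL))) w) ∈ osConeS q)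
    (hroof : ∀ (w : V5) (y' κ l t w₁ : ℝ), InS q w → 0 ≤ y' → y' ≤ 1 → 0 ≤ κ → 0 < l → 0 ≤ t → 0 ≤ w₁ → w₁ ≤ 1 →
      opBC y' (imgA q (swapAC (swapAB (roofV q κ l t w₁))) w) ∈ osConeS q) :
    HypBaS q := by
  refine hypBaS_of_gadget_endpoints hq0 hq1 (fun w y' y u0 hw hy0 hy1 hu0 hu1 => ?_) hlam hroof
  have e : swapAC (swapAB (vecB q (q * y) y 0 0 u0)) = ⟨u0, y - u0, 0, 0, 0⟩ := by
    ext <;> simp [swapAC, swapAB, vecB]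
  rw [e]
  exact opBC_imgA_deg_mem hq0 hq1.le hw hy0 hy1 hu0 (sub_nonneg.2 hu1)

end ThreeApex

end FK

end Summit.CriticalPhenomena.PercolationContinuityZ3.Theorems
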